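/-
Origin: expansion seat `planner-pub-hodgecm-pohl-g13-0`, handover #5 2026-08-18T13:42:14Z (md5 a6e9838a806c714c3969ba5ded480a4d, 302 l.; RUN 30 additive leaf; lands AFTER my #3 GaloisSpanRank (f44faa5b) AND #4 GaloisSpanQuartic (9c651f9b); rewrite imports Pohl13.GaloisSpanRank -> HodgeCM.Proofs.Pohlmann.GaloisSpanRank and Pohl13.GaloisSpanQuartic -> HodgeCM.Proofs.Pohlmann.GaloisSpanQuartic, x1 each) (`HOME/pub-hodgecm-pohl-g13/lean/Pohl13/GaloisSpanBound.lean`, md5 a6e9838a, 302 lines);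
landed by the gen-8 packager in gate run 30 as `HodgeCM/Proofs/Pohlmann/GaloisSpanBound.lean` (import ^import Pohl13\.GaloisSpanRank[ \t]*$→import HodgeCM.Proofs.Pohlmann.GaloisSpanRank ×1; import ^import Pohl13\.GaloisSpanQuartic[ \t]*$→import HodgeCM.Proofs.Pohlmann.GaloisSpanQuartic ×1).
-/
/-
Copyright: pub-hodgecm formalisation cell (harness21, 2026). New file (not vendored).
Origin: HOME/pub-hodgecm-pohl-g13/lean/Pohl13/GaloisSpanBound.lean — session planner-pub-hodgecm-pohl-g13-0 (unit pub-hodgecm-pohl-g13),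
EXPANSION part (b) `PohlmannSpan`, generation 13, file 5.  Intended final place: `HodgeCM/Proofs/Pohlmann/GaloisSpanBound.lean`
(module `HodgeCM.Proofs.Pohlmann.GaloisSpanBound`).  ADDITIVE leaf.  WIP imports `Pohl13.GaloisSpanRank` / `Pohl13.GaloisSpanQuartic`
= this seat's files 3 / 4 (rewrite to `import HodgeCM.Proofs.Pohlmann.GaloisSpanRank` / `…GaloisSpanQuartic` on landing).
-/
import Summits.HodgeConjecture.HodgeCM.Proofs.Pohlmann.GaloisSpanRank
import Summits.HodgeConjecture.HodgeCM.Proofs.Pohlmann.GaloisSpanQuartic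

/-!
# `rank_ℚ {a_σ} ≤ [E^c:ℚ]/2`: a small Galois closure forces the naive Pohlmann span to FAIL

Files 1–4 of this seat reduced the naive (old-index-set) Pohlmann span for the families of CM types of a CM field `F` to the
Galois span condition LIN(F), showed that under `Aut(F/ℚ) = {1, c}` it is the numeric condition `rank_ℚ {a_σ} = g²`
(`g = [F:ℚ]/2`, `a_σ(s, x) = [σs = x] − [σs = x̄]`, `σ ∈ Gal(E^c/ℚ)`), and settled every CM field of degree `≤ 4` (LIN holds).
This file bounds the rank by the size of the Galois group and derives a ONE-NUMBER FAILURE TEST.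

* `NonGalois.barAut F n ∈ Gal(E^c/ℚ)` — complex conjugation restricted to `E^c ⊆ ℂ` (`GaoUllmo.autOfEmb`); `galF_barAut`: it acts
  on `Hom(F, ℂ)` as `s ↦ s̄`; `antiInd_galF_barAut_mul`: `a_{cσ} = −a_σ`.
* `NonGalois.two_mul_finrank_galAntiSpan_le` — **rank bound** `2 · rank_ℚ {a_σ} ≤ [E^c : ℚ]` for every CM field and level
  (the `a_σ` with `σ s₀ ∈ Θ` already span, up to sign, and they are half of `Gal(E^c/ℚ)`; `|Gal(E^c/ℚ)| = [E^c:ℚ]` because `E^c/ℚ`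
  is Galois, file 4).
* `NonGalois.two_mul_sq_le_finrank_galoisClosure` — **THEOREM**: `Aut(F/ℚ) = {1, c}` and LIN(F) force `2 g² ≤ [E^c : ℚ]`;
  contrapositive `not_galSpanCondition_of_finrank_galoisClosure_lt₀`: **`[F^c : ℚ] < 2 g²` (closure of `F` itself, level `0`)
  ⇒ LIN fails at every level** ⇒ some index sets disagree (`not_forall_indexSetsAgree_of_finrank_galoisClosure_lt`).
* `NonGalois.autPair_of_not_isGalois` — `Aut(F/ℚ) = {1, c}` is AUTOMATIC for non-Galois CM fields of degree `2q`, `q` prime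
  (`|Aut(F/ℚ)|` is even — `orderOf_conjAlgEquiv` — divides `[F:ℚ]` — `natCard_algEquiv_dvd_finrank` — and is not `[F:ℚ]`);
  `autPair_of_finrank_eq_four`, `autPair_of_finrank_eq_six`.
* `NonGalois.not_galSpanCondition_of_finrank_eq_six` — **every non-Galois SEXTIC CM field whose Galois closure has degree `< 18`
  (i.e. `12`) violates LIN** — the general form of pohl-g11/g12's `K₂` (closure `C₂ × S₃`); the "order 24 / 48" sextics are not
  excluded (`18 ≤ 24`), matching pohl-g12's side computation.
* `NonGalois.eight_le_finrank_galoisClosure_of_finrank_eq_four` — the bound is sharp (non-Galois quartics: LIN holds, closure `8 = 2·2²`).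
* `Universe.not_forall_naivePohlmannSpanAt_of_finrank_galoisClosure_lt` / `_of_finrank_eq_six` — under the model axioms and
  N1–N3: for such fields the naive Pohlmann span FAILS at some `(n, Θ, p)`.

Nothing is posited; nothing is cited.
-/

noncomputable section

open scoped TensorProduct NumberField BigOperators
open NumberField NumberField.ComplexEmbedding

attribute [local instance] Classical.propDecidable

namespace HodgeCM

open Literature.AlgebraicGeometry.Motives (CMType HodgeStructure)
open HodgeCM.Pohlmann HodgeCM.GaoUllmo HodgeCM.CMTypeOps

namespace NonGalois

/-! ### Complex conjugation as an element of `Gal(E^c/ℚ)` -/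

section Bar

variable (F : Type) [Field F] [NumberField F] (n : ℕ)

/-- Complex conjugation restricted to `E^c ⊆ ℂ` (`E = F^{n+1}`), as a `ℚ`-algebra map `E^c → ℂ`. -/
def barAlgHom : galoisClosure (Fin (n + 1) → F) →ₐ[ℚ] ℂ :=
  ((starRingEnd ℂ).comp (galoisClosure (Fin (n + 1) → F)).val.toRingHom).toRatAlgHom

/-- The element `c ∈ Gal(E^c/ℚ)` induced by complex conjugation (`GaoUllmo.autOfEmb` of `barAlgHom`). -/
def barAut : galoisClosure (Fin (n + 1) → F) ≃ₐ[ℚ] galoisClosure (Fin (n + 1) → F) :=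
  autOfEmb (barAlgHom F n)

variable {F n}

/-- `c` acts on `Hom(F, ℂ)` as `s ↦ s̄`. -/
theorem galF_barAut (s : F →+* ℂ) : galF n (barAut F n) s = conjugate s := by
  refine RingHom.ext fun a => ?_
  show galF n (autOfEmb (barAlgHom F n)) s a = _
  rw [galF_autOfEmb_apply]
  rfl

/-- (Ported verbatim from the HodgeCMPerL package; no docstring in the source.) -/
theorem galF_barAut_mul (σ : galoisClosure (Fin (n + 1) → F) ≃ₐ[ℚ] galoisClosure (Fin (n + 1) → F)) (s : F →+* ℂ) :
    galF n (barAut F n * σ) s = conjugate (galF n σ s) := by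
  rw [galF_mul, galF_barAut]

/-- `a_{cσ} = −a_σ`. -/
theorem antiInd_galF_barAut_mul (σ : galoisClosure (Fin (n + 1) → F) ≃ₐ[ℚ] galoisClosure (Fin (n + 1) → F)) :
    antiInd (galF n (barAut F n * σ)) = -antiInd (galF n σ) := by
  funext q
  obtain ⟨s, x⟩ := q
  rw [Pi.neg_apply, antiInd_eq_sgnAt, antiInd_eq_sgnAt, galF_barAut_mul, sgnAt_conjugate_left]

/-- (Ported verbatim from the HodgeCMPerL package; no docstring in the source.) -/
theorem barAut_mul_ne [IsTotallyComplex F] (σ : galoisClosure (Fin (n + 1) → F) ≃ₐ[ℚ] galoisClosure (Fin (n + 1) → F)) : barAut F n * σ ≠ σ := by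
  intro h
  obtain ⟨s⟩ : Nonempty (F →+* ℂ) := by
    have hc : 0 < Fintype.card (F →+* ℂ) := by rw [Embeddings.card]; exact Module.finrank_pos
    exact Fintype.card_pos_iff.mp hc
  have h1 := galF_barAut_mul σ s
  rw [h] at h1
  exact conjugate_ne (galF n σ s) h1.symm

end Bar


/-! ### `Aut(F/ℚ) = {1, c}` is automatic in degree `2q`, `q` prime, off the Galois case -/

section AutPairOfDegree

variable {F : Type} [Field F] [NumberField F]

/-- `|Aut(F/ℚ)|` divides `[F:ℚ]` (`F / F^{Aut}` is Galois with group `Aut(F/ℚ)`). -/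
theorem natCard_algEquiv_dvd_finrank : Nat.card (F ≃ₐ[ℚ] F) ∣ Module.finrank ℚ F := by
  have h := IntermediateField.finrank_fixedField_eq_card (F := ℚ) (E := F) (H := ⊤)
  rw [Subgroup.card_top] at h
  have hmul := Module.finrank_mul_finrank ℚ (IntermediateField.fixedField (⊤ : Subgroup (F ≃ₐ[ℚ] F))) F
  rw [h] at hmul
  exact Dvd.intro_left _ hmul

variable [IsCMField F]

/-- (Ported verbatim from the HodgeCMPerL package; no docstring in the source.) -/
theorem conjAlgEquiv_ne_refl : conjAlgEquiv F ≠ AlgEquiv.refl := by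
  intro h
  apply IsCMField.complexConj_ne_one F
  ext x
  have hx := congr_arg (fun e : F ≃ₐ[ℚ] F => e x) h
  simpa using hx

/-- (Ported verbatim from the HodgeCMPerL package; no docstring in the source.) -/
theorem orderOf_conjAlgEquiv : orderOf (conjAlgEquiv F) = 2 := by
  refine orderOf_eq_prime_iff.mpr ⟨?_, conjAlgEquiv_ne_refl⟩
  ext x
  rw [sq, AlgEquiv.mul_apply, conjAlgEquiv_apply, conjAlgEquiv_apply, IsCMField.complexConj_apply_apply, AlgEquiv.one_apply]

/-- (Ported verbatim from the HodgeCMPerL package; no docstring in the source.) -/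
theorem two_dvd_natCard_algEquiv : 2 ∣ Nat.card (F ≃ₐ[ℚ] F) :=
  orderOf_conjAlgEquiv (F := F) ▸ orderOf_dvd_natCard (conjAlgEquiv F)

/-- **Non-Galois CM fields of degree `2q`, `q` prime, have `Aut(F/ℚ) = {1, c}`** (`|Aut|` is even, divides `2q`, and is not
`2q`).  So `AutPair` is automatic for non-Galois quartic, sextic, degree-10, degree-14, … CM fields. -/
theorem autPair_of_not_isGalois {q : ℕ} (hq : q.Prime) (hdeg : Module.finrank ℚ F = 2 * q) (hF : ¬ IsGalois ℚ F) :
    AutPair F := by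
  have hne : Nat.card (F ≃ₐ[ℚ] F) ≠ Module.finrank ℚ F := fun h => hF (IsGalois.of_card_aut_eq_finrank ℚ F h)
  have hdvd := natCard_algEquiv_dvd_finrank (F := F)
  obtain ⟨e, he⟩ := two_dvd_natCard_algEquiv (F := F)
  rw [hdeg, he] at hne hdvd
  rcases hq.eq_one_or_self_of_dvd e (Nat.dvd_of_mul_dvd_mul_left (by norm_num) hdvd) with h1 | h1
  · have h2 : Nat.card (F ≃ₐ[ℚ] F) = 2 := by rw [he, h1]
    obtain ⟨y, -, huniq⟩ := (Nat.card_eq_two_iff' (AlgEquiv.refl : F ≃ₐ[ℚ] F)).mp h2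
    have hc : conjAlgEquiv F = y := huniq _ conjAlgEquiv_ne_refl
    intro g
    by_cases hg : g = AlgEquiv.refl
    · exact Or.inl hg
    · exact Or.inr ((huniq g hg).trans hc.symm)
  · exact (hne (by rw [h1])).elim

/-- In particular for quartic and sextic CM fields. -/
theorem autPair_of_finrank_eq_four (h4 : Module.finrank ℚ F = 4) (hF : ¬ IsGalois ℚ F) : AutPair F :=
  autPair_of_not_isGalois Nat.prime_two (by rw [h4]) hF

/-- (Ported verbatim from the HodgeCMPerL package; no docstring in the source.) -/
theorem autPair_of_finrank_eq_six (h6 : Module.finrank ℚ F = 6) (hF : ¬ IsGalois ℚ F) : AutPair F :=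
  autPair_of_not_isGalois Nat.prime_three (by rw [h6]) hF

end AutPairOfDegree

/-! ### The rank bound -/

section Bound

variable {F : Type} [Field F] [NumberField F] {n : ℕ}

/-- Half of `Gal(E^c/ℚ)` already spans: `{a_σ} ⊆ ± {a_σ : σ s₀ ∈ Θ}`. -/
theorem galAntiSpan_le_span_image (Θ : CMType F) (s₀ : F →+* ℂ) :
    galAntiSpan F n ≤ Submodule.span ℚ
      (((Finset.univ.filter fun σ : galoisClosure (Fin (n + 1) → F) ≃ₐ[ℚ] galoisClosure (Fin (n + 1) → F) =>
          galF n σ s₀ ∈ Θ.1).image fun σ => antiInd (galF n σ)) : Set ((F →+* ℂ) × (F →+* ℂ) → ℚ)) := by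
  apply Submodule.span_le.mpr
  rintro _ ⟨σ, rfl⟩
  by_cases hσ : galF n σ s₀ ∈ Θ.1
  · apply Submodule.subset_span
    rw [Finset.coe_image]
    exact ⟨σ, by rw [Finset.mem_coe, Finset.mem_filter]; exact ⟨Finset.mem_univ _, hσ⟩, rfl⟩
  · have hc : galF n (barAut F n * σ) s₀ ∈ Θ.1 := by
      rw [galF_barAut_mul]; exact (conjugate_mem_iff_notMem Θ _).mpr hσ
    have hmem : antiInd (galF n (barAut F n * σ)) ∈ Submodule.span ℚ
        (((Finset.univ.filter fun σ : galoisClosure (Fin (n + 1) → F) ≃ₐ[ℚ] galoisClosure (Fin (n + 1) → F) =>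
            galF n σ s₀ ∈ Θ.1).image fun σ => antiInd (galF n σ)) : Set ((F →+* ℂ) × (F →+* ℂ) → ℚ)) := by
      apply Submodule.subset_span
      rw [Finset.coe_image]
      exact ⟨barAut F n * σ, by rw [Finset.mem_coe, Finset.mem_filter]; exact ⟨Finset.mem_univ _, hc⟩, rfl⟩
    rw [antiInd_galF_barAut_mul] at hmem
    simpa using (Submodule.span ℚ _).neg_mem hmem

/-- The half has exactly `|Gal(E^c/ℚ)|/2` elements (`σ ↦ cσ` swaps it with its complement). -/
theorem two_mul_card_filter (Θ : CMType F) (s₀ : F →+* ℂ) :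
    2 * (Finset.univ.filter fun σ : galoisClosure (Fin (n + 1) → F) ≃ₐ[ℚ] galoisClosure (Fin (n + 1) → F) =>
        galF n σ s₀ ∈ Θ.1).card =
      Fintype.card (galoisClosure (Fin (n + 1) → F) ≃ₐ[ℚ] galoisClosure (Fin (n + 1) → F)) := by
  set R := Finset.univ.filter fun σ : galoisClosure (Fin (n + 1) → F) ≃ₐ[ℚ] galoisClosure (Fin (n + 1) → F) =>
    galF n σ s₀ ∈ Θ.1 with hR
  have hmaps₁ : Set.MapsTo (fun σ => barAut F n * σ) (R : Set _) (Rᶜ : Finset _) := by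
    intro σ hσ
    rw [Finset.mem_coe, hR, Finset.mem_filter] at hσ
    rw [Finset.mem_coe, Finset.mem_compl, hR, Finset.mem_filter, not_and, galF_barAut_mul]
    exact fun _ => (mem_iff_conjugate_notMem Θ _).mp hσ.2
  have hmaps₂ : Set.MapsTo (fun σ => barAut F n * σ) ((Rᶜ : Finset _) : Set _) R := by
    intro σ hσ
    rw [Finset.mem_coe, Finset.mem_compl, hR, Finset.mem_filter, not_and] at hσ
    rw [Finset.mem_coe, hR, Finset.mem_filter, galF_barAut_mul]
    exact ⟨Finset.mem_univ _, (conjugate_mem_iff_notMem Θ _).mpr (hσ (Finset.mem_univ _))⟩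
  have hinj : ∀ S : Set (galoisClosure (Fin (n + 1) → F) ≃ₐ[ℚ] galoisClosure (Fin (n + 1) → F)),
      S.InjOn fun σ => barAut F n * σ := fun S σ _ τ _ h => mul_left_cancel h
  have h₁ := Finset.card_le_card_of_injOn _ hmaps₁ (hinj _)
  have h₂ := Finset.card_le_card_of_injOn _ hmaps₂ (hinj _)
  have h₃ := Finset.card_add_card_compl R
  omega

variable [IsCMField F]

/-- **Rank bound.**  `2 · rank_ℚ {a_σ} ≤ |Gal(E^c/ℚ)|`. -/
theorem two_mul_finrank_galAntiSpan_le_card :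
    2 * Module.finrank ℚ (galAntiSpan F n) ≤
      Fintype.card (galoisClosure (Fin (n + 1) → F) ≃ₐ[ℚ] galoisClosure (Fin (n + 1) → F)) := by
  obtain ⟨s₀⟩ : Nonempty (F →+* ℂ) := by
    have hc : 0 < Fintype.card (F →+* ℂ) := by rw [Embeddings.card]; exact Module.finrank_pos
    exact Fintype.card_pos_iff.mp hc
  rw [← two_mul_card_filter (placesType F) s₀]
  apply Nat.mul_le_mul_left
  exact (Submodule.finrank_mono (galAntiSpan_le_span_image (placesType F) s₀)).trans
    ((finrank_span_finset_le_card _).trans Finset.card_image_le)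

/-- **Rank bound, Galois form.**  `2 · rank_ℚ {a_σ} ≤ [E^c : ℚ]` (`E^c/ℚ` is Galois, file 4). -/
theorem two_mul_finrank_galAntiSpan_le :
    2 * Module.finrank ℚ (galAntiSpan F n) ≤ Module.finrank ℚ (galoisClosure (Fin (n + 1) → F)) := by
  rw [← IsGalois.card_aut_eq_finrank, Nat.card_eq_fintype_card]
  exact two_mul_finrank_galAntiSpan_le_card

/-- **THEOREM.**  If `Aut(F/ℚ) = {1, c}` and LIN(F) holds, then `2 g² ≤ [E^c : ℚ]` (`g = [F:ℚ]/2`): the Galois closure must be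
large. -/
theorem two_mul_sq_le_finrank_galoisClosure (hA : AutPair F) (h : GalSpanCondition F n) :
    2 * (Module.finrank ℚ F / 2) ^ 2 ≤ Module.finrank ℚ (galoisClosure (Fin (n + 1) → F)) := by
  rw [← (galSpanCondition_iff_finrank_eq hA).mp h]
  exact two_mul_finrank_galAntiSpan_le

/-- **Small Galois closure ⇒ LIN fails** (at the level where the closure is measured) … -/
theorem not_galSpanCondition_of_finrank_galoisClosure_lt (hA : AutPair F)
    (hlt : Module.finrank ℚ (galoisClosure (Fin (n + 1) → F)) < 2 * (Module.finrank ℚ F / 2) ^ 2) :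
    ¬ GalSpanCondition F n :=
  fun h => absurd (two_mul_sq_le_finrank_galoisClosure hA h) (not_le.mpr hlt)

/-- … hence at every level, measuring the closure of `F = F¹` itself (`n = 0`; LIN is level-independent, file 1). -/
theorem not_galSpanCondition_of_finrank_galoisClosure_lt₀ (hA : AutPair F)
    (hlt : Module.finrank ℚ (galoisClosure (Fin (0 + 1) → F)) < 2 * (Module.finrank ℚ F / 2) ^ 2) (m : ℕ) :
    ¬ GalSpanCondition F m :=
  fun h => not_galSpanCondition_of_finrank_galoisClosure_lt hA hlt ((galSpanCondition_iff m 0).mp h)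

/-- So some index sets disagree. -/
theorem not_forall_indexSetsAgree_of_finrank_galoisClosure_lt (hA : AutPair F)
    (hlt : Module.finrank ℚ (galoisClosure (Fin (0 + 1) → F)) < 2 * (Module.finrank ℚ F / 2) ^ 2) :
    ¬ ∀ (m : ℕ) (Θ : Fin (m + 1) → CMType F) (p : ℕ), IndexSetsAgree Θ p :=
  fun h => not_galSpanCondition_of_finrank_galoisClosure_lt₀ hA hlt 0 (galSpanCondition_of_indexSetsAgree 0 h)

/-- **Non-Galois SEXTIC CM fields with Galois closure of degree `< 18`, i.e. `= 12`** (the first case of pohl-g12's side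
computation; pohl-g11's `K₂` is one): LIN fails for EVERY such field (`Aut(F/ℚ) = {1, c}` is automatic here). -/
theorem not_galSpanCondition_of_finrank_eq_six (h6 : Module.finrank ℚ F = 6) (hF : ¬ IsGalois ℚ F)
    (hlt : Module.finrank ℚ (galoisClosure (Fin (0 + 1) → F)) < 18) (m : ℕ) : ¬ GalSpanCondition F m :=
  not_galSpanCondition_of_finrank_galoisClosure_lt₀ (autPair_of_finrank_eq_six h6 hF) (by rw [h6]; exact hlt) m

/-- The bound is SHARP: a non-Galois quartic CM field satisfies LIN (file 4), so its Galois closures have degree `≥ 2·2² = 8`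
(the closure of `F` itself is dihedral of order `8`). -/
theorem eight_le_finrank_galoisClosure_of_finrank_eq_four (h4 : Module.finrank ℚ F = 4) (hF : ¬ IsGalois ℚ F) (n : ℕ) :
    8 ≤ Module.finrank ℚ (galoisClosure (Fin (n + 1) → F)) := by
  have h := two_mul_sq_le_finrank_galoisClosure (autPair_of_finrank_eq_four h4 hF) (galSpanCondition_of_finrank_eq_four h4 n)
  rw [h4] at h
  exact h

end Bound

end NonGalois

/-! ### Universe level -/

namespace Universe

open NonGalois

variable {U : Universe}

/-- **Small Galois closure ⇒ the naive Pohlmann span fails somewhere** (model axioms + N1–N3): for a CM field with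
`Aut(F/ℚ) = {1, c}` and `[F̃ : ℚ] < 2 g²` there are `n, Θ, p` at which the Hodge classes of `A_Θ` are NOT spanned by the weight
vectors of the old index set. -/
theorem not_forall_naivePohlmannSpanAt_of_finrank_galoisClosure_lt (M : U.ModelAxioms) (hN1 : U.Fact_cupExterior)
    (hN2 : U.Fact_cup_hodge) (hN3 : U.Fact_pull_H0) (F : CMField) (hA : AutPair F)
    (hlt : Module.finrank ℚ (galoisClosure (Fin (0 + 1) → (F : Type))) < 2 * F.halfDegree ^ 2) :
    ¬ ∀ (n : ℕ) (Θ : Fin (n + 1) → CMType F) (p : ℕ), U.NaivePohlmannSpanAt F Θ p := by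
  rw [forall_naivePohlmannSpanAt_iff_galSpanCondition M hN1 hN2 hN3]
  exact not_galSpanCondition_of_finrank_galoisClosure_lt₀ hA hlt 0

/-- **Sextic, non-Galois, Galois closure of degree `12` (`< 18`) ⇒ the naive Pohlmann span fails somewhere** — for every such CM
field, not just `K₂` (model axioms + N1–N3). -/
theorem not_forall_naivePohlmannSpanAt_of_finrank_eq_six (M : U.ModelAxioms) (hN1 : U.Fact_cupExterior)
    (hN2 : U.Fact_cup_hodge) (hN3 : U.Fact_pull_H0) (F : CMField) (h6 : Module.finrank ℚ F = 6) (hF : ¬ IsGalois ℚ F)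
    (hlt : Module.finrank ℚ (galoisClosure (Fin (0 + 1) → (F : Type))) < 18) :
    ¬ ∀ (n : ℕ) (Θ : Fin (n + 1) → CMType F) (p : ℕ), U.NaivePohlmannSpanAt F Θ p := by
  rw [forall_naivePohlmannSpanAt_iff_galSpanCondition M hN1 hN2 hN3]
  exact not_galSpanCondition_of_finrank_eq_six h6 hF hlt 0

end Universe

end HodgeCM
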